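import Literature.RingTheory.FittingIdeal.FittingLemma
import Mathlib.LinearAlgebra.Matrix.Adjugate
import Mathlib.RingTheory.Nakayama
import Mathlib.RingTheory.LocalRing.MaximalIdeal.Basic
import Mathlib.Algebra.Module.Torsion.Basic
import HarnessLib

/-!
# A module with principal Fitting ideal `Fitt_k = (f)` is generated by `k` elements modulo its
# `f`-torsion (Stacks 080Z)

Topic: `Literature/RingTheory/FittingIdeal`. The Stacks Project, Tag 080Z (More on Algebra,
Lemma 15.8.9): "Let `R` be a local ring. Let `M` be a finite `R`-module. Let `k ≥ 0`. Assume
that `Fit_k(M) = (f)` for some `f ∈ R`. Let `M'` be the quotient of `M` by `{x ∈ M ∣ fx = 0}`.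
Then `M'` can be generated by `k` elements." This is the local algebra behind flattening by
blowing up a Fitting ideal (Stacks, Tag 0810, Step 8; Raynaud–Gruson 1971, 5.4): after the
blowing up the Fitting ideal becomes invertible, and the strict transform (the quotient by the
torsion of a local equation) becomes locally generated by `k` sections.

Proof as printed: choose generators `x₁, …, xₙ`; `Fit_k(M)` is generated by the
`(n-k) × (n-k)` minors of relation matrices (Fitting's lemma,
`Module.fittingIdeal_eq_relMinorIdeal`); `R` being local, one such minor `det P` already
generates `(f)` ("Algebra, Lemma 10.20.1" — Nakayama), say `det P = u f` with `u` a unit, for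
relations `ρ₁, …, ρ_{n-k}` and columns `σ`; multiplying the relations by the adjugate of `P`
("Algebra, Lemma 10.15.6" = Tag 080R) gives relations with coefficient `u f` on `x_{σ i}`, `0`
on the other `x_{σ i'}`, and — by Cramer's rule — a relation minor, hence a multiple `c f` of
`f`, on each remaining generator; so `f · (u x_{σ i} + ∑ c x_l) = 0`, and modulo the
`f`-torsion the `k` generators `x_l`, `l ∉ im σ`, suffice.

* `exists_det_eq_unit_mul_of_relMinorIdeal_eq_span_singleton` — over a local ring, if the
  ideal of `j`-minors of relation matrices is principal `(f)`, `f ≠ 0`, one minor is `u f`,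
  `u` a unit;
* `Module.exists_span_eq_top_quotient_torsionBy` — **Stacks 080Z**.

## References

* The Stacks Project, Tag 080Z (More on Algebra, Lemma 15.8.9), with Tags 080R, 00DV.
  [StacksProject]
* M. Raynaud, L. Gruson, *Critères de platitude et de projectivité*, Invent. Math. 13 (1971),
  Première partie, 5.4. [RaynaudGruson1971]
-/

namespace Literature.RingTheory.FittingIdeal

universe u v

open Matrix

variable {R : Type u} [CommRing R] {M : Type v} [AddCommGroup M] [Module R M]

/-! ## Nakayama: a principal ideal generated by a set is generated by one of its elements -/

/-- Over a local ring, if a set `E` generates a nonzero principal ideal `(f)`, then some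
`d ∈ E` is a unit multiple of `f` (Stacks 00DV (8): Nakayama). [cite: StacksProject, Tag 00DV] -/
theorem exists_mem_eq_unit_mul_of_span_eq_span_singleton [IsLocalRing R] {E : Set R} {f : R}
    (hE : Ideal.span E = Ideal.span {f}) (hf : f ≠ 0) :
    ∃ d ∈ E, ∃ u : R, IsUnit u ∧ d = u * f := by
  classical
  by_contra hcon
  -- every `d ∈ E` lies in `𝔪 · (f)`
  have hle : Ideal.span E ≤ IsLocalRing.maximalIdeal R • Ideal.span {f} := by
    refine Ideal.span_le.mpr fun d hd => ?_
    have hdf : d ∈ Ideal.span {f} := hE ▸ Ideal.subset_span hd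
    obtain ⟨a, rfl⟩ := Ideal.mem_span_singleton'.mp hdf
    have ha : ¬IsUnit a := fun hu => hcon ⟨_, hd, a, hu, rfl⟩
    rw [Ideal.smul_eq_mul]
    exact Ideal.mul_mem_mul ((IsLocalRing.mem_maximalIdeal a).mpr ha) (Ideal.mem_span_singleton_self f)
  rw [hE] at hle
  have hbot : Ideal.span ({f} : Set R) = ⊥ :=
    Submodule.eq_bot_of_le_smul_of_le_jacobson_bot _ _ (Submodule.fg_span_singleton f) hle
      (IsLocalRing.maximalIdeal_le_jacobson ⊥)
  exact hf (Ideal.span_singleton_eq_bot.mp hbot)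

/-- Over a local ring, if the ideal of `j × j` minors of relation matrices among `x₁, …, xₙ` is
a nonzero principal ideal `(f)`, then one such minor equals `u f` with `u` a unit.
[cite: StacksProject, Tag 080Z (proof)] -/
theorem exists_det_eq_unit_mul_of_relMinorIdeal_eq_span_singleton [IsLocalRing R] {n j : ℕ}
    (x : Fin n → M) {f : R} (h : Module.relMinorIdeal R x j = Ideal.span {f}) (hf : f ≠ 0) :
    ∃ (ρ : Fin j → Fin n → R) (σ : Fin j → Fin n) (u : R), (∀ i, ∑ l, ρ i l • x l = 0) ∧
      IsUnit u ∧ Matrix.det (Matrix.of fun i i' => ρ i (σ i')) = u * f := by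
  obtain ⟨d, ⟨ρ, σ, hρ, rfl⟩, u, hu, hd⟩ := exists_mem_eq_unit_mul_of_span_eq_span_singleton h hf
  exact ⟨ρ, σ, u, hρ, hu, hd⟩

/-! ## Stacks 080Z -/

/-- Generation by `k` elements passes to quotients and survives padding: if `M` is generated
by a family indexed by a type of cardinality `≤ k`, it is generated by a `Fin k`-family.
[folklore] -/
theorem exists_fin_span_eq_top_of_card_le {ι : Type*} [Fintype ι] {k : ℕ} (hk : Fintype.card ι ≤ k)
    (y : ι → M) (hy : Submodule.span R (Set.range y) = ⊤) :
    ∃ z : Fin k → M, Submodule.span R (Set.range z) = ⊤ := by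
  classical
  obtain ⟨e⟩ : Nonempty (ι ↪ Fin k) :=
    Function.Embedding.nonempty_of_card_le (by rwa [Fintype.card_fin])
  refine ⟨fun i => if h : ∃ a, e a = i then y h.choose else 0, ?_⟩
  apply top_unique
  rw [← hy]
  refine Submodule.span_le.mpr ?_
  rintro _ ⟨a, rfl⟩
  have hmem : (fun i => if h : ∃ a, e a = i then y h.choose else 0) (e a) ∈
      Set.range (fun i => if h : ∃ a, e a = i then y h.choose else 0) := ⟨e a, rfl⟩
  have hex : ∃ a', e a' = e a := ⟨a, rfl⟩
  have hch : hex.choose = a := e.injective hex.choose_spec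
  simp only [dif_pos hex, hch] at hmem
  exact Submodule.subset_span hmem

/-- **Stacks, Tag 080Z** (More on Algebra, Lemma 15.8.9). Let `R` be a local ring, `M` a
finite `R`-module, `k ≥ 0`, and assume `Fit_k(M) = (f)` for some `f ∈ R`. Then the quotient
`M' = M / {x ∈ M ∣ f x = 0}` of `M` by its `f`-torsion can be generated by `k` elements.
[cite: StacksProject, Tag 080Z] -/
theorem Module.exists_span_eq_top_quotient_torsionBy [IsLocalRing R] [Module.Finite R M] {k : ℕ}
    {f : R} (h : Module.fittingIdeal R M k = Ideal.span {f}) :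
    ∃ y : Fin k → M ⧸ Submodule.torsionBy R M f, Submodule.span R (Set.range y) = ⊤ := by
  classical
  -- the case `f = 0`: the quotient is zero
  by_cases hf : f = 0
  · refine ⟨fun _ => 0, top_unique fun m _ => ?_⟩
    induction m using Submodule.Quotient.induction_on with
    | H m =>
      have : (Submodule.Quotient.mk m : M ⧸ Submodule.torsionBy R M f) = 0 := by
        rw [Submodule.Quotient.mk_eq_zero, Submodule.mem_torsionBy_iff, hf, zero_smul]
      rw [this]
      exact Submodule.zero_mem _
  -- generators `x₁, …, xₙ`
  obtain ⟨n, x, hx⟩ := Module.Finite.exists_fin (R := R) (M := M)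
  -- the images of the generators generate the quotient
  have hxq : Submodule.span R (Set.range ((Submodule.torsionBy R M f).mkQ ∘ x)) = ⊤ := by
    rw [Set.range_comp, Submodule.span_image, hx, Submodule.map_top, Submodule.range_mkQ]
  -- if `n ≤ k` there is nothing to prove
  by_cases hnk : n ≤ k
  · exact exists_fin_span_eq_top_of_card_le (by rwa [Fintype.card_fin]) _ hxq
  obtain ⟨m, rfl⟩ : ∃ m, n = m + k := ⟨n - k, by omega⟩
  -- `Fit_k(M) = (f)` is the ideal of `m × m` relation minors; one of them is `u f`
  have hrel : Module.relMinorIdeal R x m = Ideal.span {f} := by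
    rw [← h, Module.fittingIdeal_eq_relMinorIdeal x hx k, Nat.add_sub_cancel]
  obtain ⟨ρ, σ, u, hρ, hu, hdet⟩ :=
    exists_det_eq_unit_mul_of_relMinorIdeal_eq_span_singleton x hrel hf
  -- the columns `σ` are distinct (otherwise the minor, hence `f`, vanishes)
  have hσ : Function.Injective σ := by
    intro i₁ i₂ h12
    by_contra hne
    have h0 : Matrix.det (Matrix.of fun i i' => ρ i (σ i')) = 0 :=
      Matrix.det_zero_of_column_eq hne fun i => by simp [h12]
    rw [hdet] at h0
    exact hf ((hu.mul_right_eq_zero).mp h0)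
  -- every other relation minor is a multiple of `f`: Cramer coefficients
  set P : Matrix (Fin m) (Fin m) R := Matrix.of fun i i' => ρ i (σ i') with hP
  have hminor : ∀ (i : Fin m) (l : Fin (m + k)), ∃ c : R,
      Matrix.cramer P (fun j => ρ j l) i = c * f := fun i l => by
    have hmem : Matrix.cramer P (fun j => ρ j l) i ∈ Module.relMinorIdeal R x m := by
      rw [Matrix.cramer_apply]
      have e : P.updateCol i (fun j => ρ j l) = Matrix.of fun j i' => ρ j (Function.update σ i l i') := by
        ext j i'
        rw [Matrix.updateCol_apply, Matrix.of_apply, Function.update_apply]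
        split_ifs <;> rfl
      rw [e]
      exact Module.det_mem_relMinorIdeal x ρ hρ _
    rw [hrel] at hmem
    obtain ⟨a, ha⟩ := Ideal.mem_span_singleton'.mp hmem
    exact ⟨a, ha.symm⟩
  choose c hc using hminor
  -- the new relations `∑ⱼ adj(P)ᵢⱼ ρⱼ` read `f · (u x_{σ i} + ∑_{l ∉ im σ} c_{il} x_l) = 0`
  have htors : ∀ i : Fin m,
      u • x (σ i) + ∑ l ∈ (Finset.univ.filter fun l => l ∉ Set.range σ), c i l • x l ∈
        Submodule.torsionBy R M f := fun i => by
    rw [Submodule.mem_torsionBy_iff]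
    -- the relation `ρ' = ∑ⱼ adj(P) i j • ρ j`
    have hρ' : ∑ l, (∑ j, P.adjugate i j * ρ j l) • x l = 0 := by
      simp_rw [Finset.sum_smul, mul_smul]
      rw [Finset.sum_comm]
      simp_rw [← Finset.smul_sum, hρ, smul_zero, Finset.sum_const_zero]
    -- its coefficients: `(adj P *ᵥ col_l) i = cramer P col_l i = c i l * f`
    have hcoef : ∀ l, ∑ j, P.adjugate i j * ρ j l = c i l * f := fun l => by
      rw [← hc i l, Matrix.cramer_eq_adjugate_mulVec]
      rfl
    -- on the columns `σ i'`: `(adj P * P) i i' = det P • δ`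
    have hcoefσ : ∀ i', ∑ j, P.adjugate i j * ρ j (σ i') = if i = i' then u * f else 0 := fun i' => by
      have e := congrFun (congrFun (Matrix.adjugate_mul P) i) i'
      rw [Matrix.mul_apply, Matrix.smul_apply, Matrix.one_apply, smul_eq_mul, hdet] at e
      simp only [hP, Matrix.of_apply] at e ⊢
      rw [e]
      split_ifs <;> simp
    -- split the sum over `l` into `im σ` and its complement
    rw [← Finset.sum_filter_add_sum_filter_not Finset.univ (fun l => l ∈ Set.range σ)] at hρ'
    have h1 : ∑ l ∈ Finset.univ.filter (fun l => l ∈ Set.range σ),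
        (∑ j, P.adjugate i j * ρ j l) • x l = (u * f) • x (σ i) := by
      have himg : Finset.univ.filter (fun l : Fin (m + k) => l ∈ Set.range σ) =
          Finset.univ.image σ := by
        ext l
        simp [Set.mem_range, Finset.mem_image]
      rw [himg, Finset.sum_image fun a _ b _ hab => hσ hab]
      simp_rw [hcoefσ]
      simp [Finset.sum_ite_eq, ite_smul, zero_smul]
    have h2 : ∑ l ∈ Finset.univ.filter (fun l => l ∉ Set.range σ),
        (∑ j, P.adjugate i j * ρ j l) • x l =
          f • ∑ l ∈ Finset.univ.filter (fun l => l ∉ Set.range σ), c i l • x l := by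
      rw [Finset.smul_sum]
      refine Finset.sum_congr rfl fun l _ => ?_
      rw [hcoef, mul_comm, mul_smul]
    rw [h1, h2] at hρ'
    rw [smul_add, smul_smul, mul_comm f u]
    exact hρ'
  -- hence modulo the `f`-torsion every `x_{σ i}` lies in the span of the `x_l`, `l ∉ im σ`
  let T : Set (Fin (m + k)) := (Set.range σ)ᶜ
  have hgen : Submodule.span R (Set.range (fun l : T => (Submodule.torsionBy R M f).mkQ (x l))) = ⊤ := by
    apply top_unique
    rw [← hxq]
    refine Submodule.span_le.mpr ?_
    rintro _ ⟨l, rfl⟩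
    by_cases hl : l ∈ Set.range σ
    · obtain ⟨i, rfl⟩ := hl
      -- `u • [x (σ i)] = - ∑ c • [x l]`
      have hq : (Submodule.torsionBy R M f).mkQ (u • x (σ i) +
          ∑ l ∈ Finset.univ.filter (fun l => l ∉ Set.range σ), c i l • x l) = 0 := by
        rw [← LinearMap.mem_ker, Submodule.ker_mkQ]
        exact htors i
      rw [map_add, map_smul, add_eq_zero_iff_eq_neg] at hq
      have hmem : u • (Submodule.torsionBy R M f).mkQ (x (σ i)) ∈
          Submodule.span R (Set.range fun l : T => (Submodule.torsionBy R M f).mkQ (x l)) := by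
        rw [hq]
        refine Submodule.neg_mem _ ?_
        rw [map_sum]
        refine Submodule.sum_mem _ fun l hl => ?_
        rw [map_smul]
        refine Submodule.smul_mem _ _ (Submodule.subset_span ⟨⟨l, ?_⟩, rfl⟩)
        exact (Finset.mem_filter.mp hl).2
      have := Submodule.smul_mem _ (↑hu.unit⁻¹ : R) hmem
      rwa [smul_smul, IsUnit.val_inv_mul, one_smul] at this
    · exact Submodule.subset_span ⟨⟨l, hl⟩, rfl⟩
  -- `T` has `k` elements
  haveI : Fintype T := Fintype.ofFinite _
  refine exists_fin_span_eq_top_of_card_le (le_of_eq ?_) _ hgen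
  change Fintype.card ((Set.range σ)ᶜ : Set (Fin (m + k))) = k
  rw [Fintype.card_compl_set, Fintype.card_fin, Set.card_range_of_injective hσ, Fintype.card_fin]
  omega

end Literature.RingTheory.FittingIdeal
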